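import Literature.Analysis.FluidPDE.OseenSliceHolderSeminorm
import Literature.Analysis.UnboundedOperators.HeatIteratedDerivBounds

/-!
# `stub_cellGaps` of line `vanishing-cell-reynolds` (crux HelicalEndLiouville, stmt-NavierStokesRegularity-14062) —
# positive evidence by the drefute seat (a prover may land it)

The lead's registered stub `stub_cellGaps` (skeleton d4c7fc4e, 2026-08-16T05:09:13Z), VERBATIM as `CellGaps` below,
proved from the cell inequality along a line (`norm_sub_lineAverage_le`, FTC twice) and the tree's
`exists_norm_iteratedFDeriv_heatExtension_le 2`, `exists_norm_iteratedFDeriv_oseenSlice_le 2`,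
`exists_norm_oseenSlice_le`, `heatExtension`/`oseenSlice` translation covariance.
-/

noncomputable section
set_option linter.dupNamespace false
open MeasureTheory Set intervalIntegral Literature.Analysis.FluidPDE Literature.Analysis
  Literature.Analysis.UnboundedOperators
open scoped ENNReal

namespace Summit.NavierStokesRegularity.NavierStokesRegularity.Cruxes.HelicalEndLiouville.DRefute

/-! ## The one-dimensional cell inequality -/

section OneD

variable {F : Type*} [NormedAddCommGroup F] [NormedSpace ℝ F] [CompleteSpace F]

/-- If `k 1 = k 0` and `‖k''‖ ≤ D` on `[0,1]` then `‖k' r‖ ≤ D` on `[0,1]`. -/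
theorem norm_deriv_le_of_periodic {k k' k'' : ℝ → F} (hk : ∀ r, HasDerivAt k (k' r) r)
    (hk' : ∀ r, HasDerivAt k' (k'' r) r) (hper : k 1 = k 0) {D : ℝ}
    (hD : ∀ r ∈ Icc (0:ℝ) 1, ‖k'' r‖ ≤ D) {r : ℝ} (hr : r ∈ Icc (0:ℝ) 1) : ‖k' r‖ ≤ D := by
  have hk'c : Continuous k' := continuous_iff_continuousAt.2 fun x => (hk' x).continuousAt
  have hD0 : 0 ≤ D := (norm_nonneg _).trans (hD 0 ⟨le_rfl, zero_le_one⟩)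
  have hmean : ∫ s in (0:ℝ)..1, k' s = 0 := by
    rw [integral_eq_sub_of_hasDerivAt (fun x _ => hk x) (hk'c.intervalIntegrable 0 1), hper, sub_self]
  have hlip : ∀ s ∈ Icc (0:ℝ) 1, ‖k' r - k' s‖ ≤ D := by
    intro s hs
    have key := (convex_Icc (0:ℝ) 1).norm_image_sub_le_of_norm_hasDerivWithin_le
      (fun x _ => (hk' x).hasDerivWithinAt) hD hs hr
    refine key.trans ?_
    have hrs : ‖r - s‖ ≤ 1 := by
      rw [Real.norm_eq_abs, abs_le]
      constructor <;> linarith [hr.1, hr.2, hs.1, hs.2]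
    calc D * ‖r - s‖ ≤ D * 1 := mul_le_mul_of_nonneg_left hrs hD0
      _ = D := mul_one D
  have hrepr : k' r = ∫ s in (0:ℝ)..1, (k' r - k' s) := by
    rw [integral_sub intervalIntegrable_const (hk'c.intervalIntegrable 0 1), hmean, sub_zero,
      intervalIntegral.integral_const]
    simp
  rw [hrepr]
  have := norm_integral_le_of_norm_le_const (a := (0:ℝ)) (b := 1) (C := D)
    (f := fun s => k' r - k' s) (fun s hs => hlip s ?_)
  · simpa using this
  · rw [uIoc_of_le zero_le_one] at hs
    exact ⟨hs.1.le, hs.2⟩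

/-- **Cell inequality.** If `k 1 = k 0` and `‖k''‖ ≤ D` on `[0,1]` then `‖k 0 − ∫₀¹ k‖ ≤ D`. -/
theorem norm_sub_average_le_of_periodic {k k' k'' : ℝ → F} (hk : ∀ r, HasDerivAt k (k' r) r)
    (hk' : ∀ r, HasDerivAt k' (k'' r) r) (hper : k 1 = k 0) {D : ℝ}
    (hD : ∀ r ∈ Icc (0:ℝ) 1, ‖k'' r‖ ≤ D) : ‖k 0 - ∫ s in (0:ℝ)..1, k s‖ ≤ D := by
  have hkc : Continuous k := continuous_iff_continuousAt.2 fun x => (hk x).continuousAt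
  have hD0 : 0 ≤ D := (norm_nonneg _).trans (hD 0 ⟨le_rfl, zero_le_one⟩)
  have hd1 : ∀ r ∈ Icc (0:ℝ) 1, ‖k' r‖ ≤ D := fun r hr => norm_deriv_le_of_periodic hk hk' hper hD hr
  have hdev : ∀ s ∈ Icc (0:ℝ) 1, ‖k 0 - k s‖ ≤ D := by
    intro s hs
    have key := (convex_Icc (0:ℝ) 1).norm_image_sub_le_of_norm_hasDerivWithin_le
      (fun x _ => (hk x).hasDerivWithinAt) hd1 ⟨le_rfl, zero_le_one⟩ hs
    rw [norm_sub_rev]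
    refine key.trans ?_
    have hs1 : ‖s - 0‖ ≤ 1 := by
      rw [sub_zero, Real.norm_eq_abs, abs_le]; constructor <;> linarith [hs.1, hs.2]
    calc D * ‖s - 0‖ ≤ D * 1 := mul_le_mul_of_nonneg_left hs1 hD0
      _ = D := mul_one D
  have hrepr : k 0 - ∫ s in (0:ℝ)..1, k s = ∫ s in (0:ℝ)..1, (k 0 - k s) := by
    rw [integral_sub intervalIntegrable_const (hkc.intervalIntegrable 0 1), intervalIntegral.integral_const]
    simp
  rw [hrepr]
  have := norm_integral_le_of_norm_le_const (a := (0:ℝ)) (b := 1) (C := D)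
    (f := fun s => k 0 - k s) (fun s hs => hdev s ?_)
  · simpa using this
  · rw [uIoc_of_le zero_le_one] at hs
    exact ⟨hs.1.le, hs.2⟩

end OneD

/-! ## Along a line in `E` -/

section Line

variable {E F : Type*} [NormedAddCommGroup E] [NormedSpace ℝ E] [NormedAddCommGroup F] [NormedSpace ℝ F]
  [CompleteSpace F]

/-- **Cell inequality along a line**: `C²` field, `h (x + L) = h x`, `‖D²h‖ ≤ B` ⇒
`‖h x − ∫₀¹ h (x + r • L) dr‖ ≤ B ‖L‖²`. -/
theorem norm_sub_lineAverage_le {h : E → F} (hh : ContDiff ℝ 2 h) (x L : E) (hper : h (x + L) = h x)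
    {B : ℝ} (hB : ∀ y, ‖iteratedFDeriv ℝ 2 h y‖ ≤ B) :
    ‖h x - ∫ r in (0:ℝ)..1, h (x + r • L)‖ ≤ B * ‖L‖ ^ 2 := by
  set p : ℝ → E := fun s => x + s • L with hp
  have hpd : ∀ s, HasDerivAt p L s := fun s => by
    simpa [hp] using ((hasDerivAt_id s).smul_const L).const_add x
  have hdiff : Differentiable ℝ h := hh.differentiable (by norm_num)
  have hdiff' : Differentiable ℝ (fderiv ℝ h) :=
    (hh.fderiv_right (m := 1) (by norm_num)).differentiable (by norm_num)
  set k : ℝ → F := fun s => h (p s) with hk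
  set k' : ℝ → F := fun s => fderiv ℝ h (p s) L with hk'
  set k'' : ℝ → F := fun s => fderiv ℝ (fderiv ℝ h) (p s) L L with hk''
  have h1 : ∀ s, HasDerivAt k (k' s) s := fun s =>
    (hdiff (p s)).hasFDerivAt.comp_hasDerivAt s (hpd s)
  have h2 : ∀ s, HasDerivAt k' (k'' s) s := by
    intro s
    have hg : HasDerivAt (fun r => fderiv ℝ h (p r)) (fderiv ℝ (fderiv ℝ h) (p s) L) s :=
      (hdiff' (p s)).hasFDerivAt.comp_hasDerivAt s (hpd s)
    have := hg.clm_apply (hasDerivAt_const s L)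
    simpa [hk', hk''] using this
  have hper' : k 1 = k 0 := by simp [hk, hp, hper]
  have hD : ∀ r ∈ Icc (0:ℝ) 1, ‖k'' r‖ ≤ B * ‖L‖ ^ 2 := by
    intro r _
    have hn : ‖fderiv ℝ (fderiv ℝ h) (p r)‖ = ‖iteratedFDeriv ℝ 2 h (p r)‖ := by
      rw [← norm_iteratedFDeriv_zero (𝕜 := ℝ) (f := fderiv ℝ (fderiv ℝ h)), norm_iteratedFDeriv_fderiv,
        norm_iteratedFDeriv_fderiv]
    calc ‖k'' r‖ ≤ ‖fderiv ℝ (fderiv ℝ h) (p r) L‖ * ‖L‖ := ContinuousLinearMap.le_opNorm _ _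
      _ ≤ ‖fderiv ℝ (fderiv ℝ h) (p r)‖ * ‖L‖ * ‖L‖ :=
          mul_le_mul_of_nonneg_right (ContinuousLinearMap.le_opNorm _ _) (norm_nonneg _)
      _ ≤ B * ‖L‖ * ‖L‖ := by
          rw [hn]
          exact mul_le_mul_of_nonneg_right (mul_le_mul_of_nonneg_right (hB _) (norm_nonneg _))
            (norm_nonneg _)
      _ = B * ‖L‖ ^ 2 := by ring
  have key := norm_sub_average_le_of_periodic h1 h2 hper' hD
  simpa [hk, hp] using key

end Line

/-! ## The two cell gaps (the lead's `stub_cellGaps`, verbatim) -/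

/-- `ℝ³`. -/
abbrev E3 : Type := EuclideanSpace ℝ (Fin 3)

/-- VERBATIM copy of the lead's registered `stub_cellGaps` (skeleton d4c7fc4e). -/
def CellGaps : Prop :=
  ∃ κ : ℝ, 0 < κ ∧ (∀ (L : E3) (g : E3 → E3) (M σ : ℝ), Continuous g → (∀ x, g (x + L) = g x) → (∀ x, ‖g x‖ ≤ M) → 0 < σ → ∀ x : E3, ‖heatExtension g σ x - ∫ r in (0:ℝ)..1, heatExtension g σ (x + r • L)‖ ≤ κ * (‖L‖ ^ 2 / σ) * M) ∧ (∀ (L : E3) (f g : E3 → E3) (Mf Mg σ : ℝ), Continuous f → Continuous g → (∀ x, f (x + L) = f x) → (∀ x, g (x + L) = g x) → (∀ x, ‖f x‖ ≤ Mf) → (∀ x, ‖g x‖ ≤ Mg) → 0 < σ → ∀ x : E3, ‖oseenSlice σ f g x - ∫ r in (0:ℝ)..1, oseenSlice σ f g (x + r • L)‖ ≤ κ * min (σ ^ (-(1 / 2 : ℝ))) (‖L‖ ^ 2 * σ ^ (-(3 / 2 : ℝ))) * Mf * Mg)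

/-- Translation covariance of the caloric extension (both sides are the same integral). -/
theorem heatExtension_comp_add_right' (φ : E3 → E3) (a : E3) (t : ℝ) (y : E3) :
    heatExtension (fun x => φ (x + a)) t y = heatExtension φ t (y + a) := by
  rw [heatExtension_apply, heatExtension_apply]
  congr 1
  funext z
  rw [sub_add_eq_add_sub]

/-- **The heat cell gap**: `‖e^{σΔ}g(x) − ∫₀¹ e^{σΔ}g(x + rL) dr‖ ≤ A₂ (‖L‖²/σ) M` for continuous
`L`-periodic `g` bounded by `M`, `A₂` the constant of `exists_norm_iteratedFDeriv_heatExtension_le 2`. -/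
theorem heat_cell_gap : ∃ A : ℝ, 0 ≤ A ∧ ∀ (L : E3) (g : E3 → E3) (M σ : ℝ), Continuous g →
    (∀ x, g (x + L) = g x) → (∀ x, ‖g x‖ ≤ M) → 0 < σ → ∀ x : E3,
      ‖heatExtension g σ x - ∫ r in (0:ℝ)..1, heatExtension g σ (x + r • L)‖ ≤ A * (‖L‖ ^ 2 / σ) * M := by
  obtain ⟨A, hA0, hA⟩ := exists_norm_iteratedFDeriv_heatExtension_le (E := E3) (F := E3) 2
  refine ⟨A, hA0, fun L g M σ hg hper hM hσ x => ?_⟩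
  have hmem : MemLp g ∞ (volume : Measure E3) :=
    memLp_top_of_bound hg.aestronglyMeasurable M (Filter.Eventually.of_forall hM)
  have hsm : ContDiff ℝ 2 (heatExtension g σ) :=
    contDiff_infty.1 (contDiff_heatExtension_holds hmem le_top hσ) 2
  have hperh : heatExtension g σ (x + L) = heatExtension g σ x := by
    rw [← heatExtension_comp_add_right' g L σ x]
    congr 1
    funext z
    exact hper z
  have hB : ∀ y, ‖iteratedFDeriv ℝ 2 (heatExtension g σ) y‖ ≤ A * σ⁻¹ * M := by
    intro y
    have key := hA hσ hg.aestronglyMeasurable hM y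
    have e : σ ^ (-((2:ℕ) : ℝ) / 2) = σ⁻¹ := by
      rw [show (-((2:ℕ) : ℝ) / 2) = -1 by norm_num, Real.rpow_neg_one]
    rwa [e] at key
  have key := norm_sub_lineAverage_le hsm x L hperh hB
  calc _ ≤ A * σ⁻¹ * M * ‖L‖ ^ 2 := key
    _ = A * (‖L‖ ^ 2 / σ) * M := by ring

/-- **The Oseen cell gap**: the oscillation over one period of `N_σ[f,g]` is at most
`max (2C₀) C₂ · min(σ^{-1/2}, ‖L‖² σ^{-3/2}) · M_f M_g`. -/
theorem oseen_cell_gap : ∃ K : ℝ, 0 ≤ K ∧ ∀ (L : E3) (f g : E3 → E3) (Mf Mg σ : ℝ), Continuous f →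
    Continuous g → (∀ x, f (x + L) = f x) → (∀ x, g (x + L) = g x) → (∀ x, ‖f x‖ ≤ Mf) →
    (∀ x, ‖g x‖ ≤ Mg) → 0 < σ → ∀ x : E3,
      ‖oseenSlice σ f g x - ∫ r in (0:ℝ)..1, oseenSlice σ f g (x + r • L)‖ ≤
        K * min (σ ^ (-(1 / 2 : ℝ))) (‖L‖ ^ 2 * σ ^ (-(3 / 2 : ℝ))) * Mf * Mg := by
  obtain ⟨C₀, hC₀, hN⟩ := exists_norm_oseenSlice_le (E := E3)
  obtain ⟨C₂, hC₂0, hD2⟩ := exists_norm_iteratedFDeriv_oseenSlice_le (E := E3) 2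
  refine ⟨max (2 * C₀) C₂, le_max_of_le_left (by positivity), fun L f g Mf Mg σ hf hg hpf hpg hMf hMg hσ x => ?_⟩
  have hMf0 : 0 ≤ Mf := (norm_nonneg _).trans (hMf 0)
  have hMg0 : 0 ≤ Mg := (norm_nonneg _).trans (hMg 0)
  set h : E3 → E3 := oseenSlice σ f g with hh
  -- branch 1: two sup bounds
  have hsup : ∀ y, ‖h y‖ ≤ C₀ * σ ^ (-(1 / 2 : ℝ)) * Mf * Mg := fun y => hN hσ hMf hMg y
  have hb1 : ‖h x - ∫ r in (0:ℝ)..1, h (x + r • L)‖ ≤ 2 * C₀ * σ ^ (-(1 / 2 : ℝ)) * Mf * Mg := by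
    have hint : ‖∫ r in (0:ℝ)..1, h (x + r • L)‖ ≤ C₀ * σ ^ (-(1 / 2 : ℝ)) * Mf * Mg := by
      have := norm_integral_le_of_norm_le_const (a := (0:ℝ)) (b := 1)
        (C := C₀ * σ ^ (-(1 / 2 : ℝ)) * Mf * Mg) (f := fun r => h (x + r • L)) (fun r _ => hsup _)
      simpa using this
    calc ‖h x - ∫ r in (0:ℝ)..1, h (x + r • L)‖
        ≤ ‖h x‖ + ‖∫ r in (0:ℝ)..1, h (x + r • L)‖ := norm_sub_le _ _
      _ ≤ C₀ * σ ^ (-(1 / 2 : ℝ)) * Mf * Mg + C₀ * σ ^ (-(1 / 2 : ℝ)) * Mf * Mg := add_le_add (hsup x) hint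
      _ = 2 * C₀ * σ ^ (-(1 / 2 : ℝ)) * Mf * Mg := by ring
  -- branch 2: the cell inequality with the second-derivative bound
  have hsm : ContDiff ℝ 2 h := contDiff_oseenSlice hσ hf.measurable hg.measurable hMf hMg
  have hperh : h (x + L) = h x := by
    rw [hh, ← oseenSlice_comp_add_right σ f g L x]
    congr 1
    · funext z; exact hpf z
    · funext z; exact hpg z
  have hB : ∀ y, ‖iteratedFDeriv ℝ 2 h y‖ ≤ C₂ * σ ^ (-(3 / 2 : ℝ)) * Mf * Mg := by
    intro y
    have key := hD2 hσ hf.measurable hg.measurable hMf hMg y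
    have e : (-(((2:ℕ) : ℝ) + 1) / 2) = -(3 / 2 : ℝ) := by norm_num
    rwa [e] at key
  have hb2 : ‖h x - ∫ r in (0:ℝ)..1, h (x + r • L)‖ ≤ C₂ * (‖L‖ ^ 2 * σ ^ (-(3 / 2 : ℝ))) * Mf * Mg := by
    have key := norm_sub_lineAverage_le hsm x L hperh hB
    calc _ ≤ C₂ * σ ^ (-(3 / 2 : ℝ)) * Mf * Mg * ‖L‖ ^ 2 := key
      _ = C₂ * (‖L‖ ^ 2 * σ ^ (-(3 / 2 : ℝ))) * Mf * Mg := by ring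
  -- combine
  have hσ1 : 0 ≤ σ ^ (-(1 / 2 : ℝ)) := Real.rpow_nonneg hσ.le _
  have hσ3 : 0 ≤ ‖L‖ ^ 2 * σ ^ (-(3 / 2 : ℝ)) := mul_nonneg (sq_nonneg _) (Real.rpow_nonneg hσ.le _)
  rcases min_choice (σ ^ (-(1 / 2 : ℝ))) (‖L‖ ^ 2 * σ ^ (-(3 / 2 : ℝ))) with hmin | hmin <;> rw [hmin]
  · calc _ ≤ 2 * C₀ * σ ^ (-(1 / 2 : ℝ)) * Mf * Mg := hb1
      _ ≤ max (2 * C₀) C₂ * σ ^ (-(1 / 2 : ℝ)) * Mf * Mg := by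
          gcongr
          exact le_max_left _ _
  · calc _ ≤ C₂ * (‖L‖ ^ 2 * σ ^ (-(3 / 2 : ℝ))) * Mf * Mg := hb2
      _ ≤ max (2 * C₀) C₂ * (‖L‖ ^ 2 * σ ^ (-(3 / 2 : ℝ))) * Mf * Mg := by
          gcongr
          exact le_max_right _ _

/-- **`stub_cellGaps` holds** (one constant for both gaps: `κ = max (max A K) 1 > 0`). -/
theorem cellGaps : CellGaps := by
  obtain ⟨A, hA0, hA⟩ := heat_cell_gap
  obtain ⟨K, hK0, hK⟩ := oseen_cell_gap
  refine ⟨max (max A K) 1, lt_max_of_lt_right one_pos, ?_, ?_⟩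
  · intro L g M σ hg hper hM hσ x
    have hM0 : 0 ≤ M := (norm_nonneg _).trans (hM 0)
    calc _ ≤ A * (‖L‖ ^ 2 / σ) * M := hA L g M σ hg hper hM hσ x
      _ ≤ max (max A K) 1 * (‖L‖ ^ 2 / σ) * M := by
          gcongr
          exact le_max_of_le_left (le_max_left _ _)
  · intro L f g Mf Mg σ hf hg hpf hpg hMf hMg hσ x
    have hMf0 : 0 ≤ Mf := (norm_nonneg _).trans (hMf 0)
    have hMg0 : 0 ≤ Mg := (norm_nonneg _).trans (hMg 0)
    have hm : 0 ≤ min (σ ^ (-(1 / 2 : ℝ))) (‖L‖ ^ 2 * σ ^ (-(3 / 2 : ℝ))) :=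
      le_min (Real.rpow_nonneg hσ.le _) (mul_nonneg (sq_nonneg _) (Real.rpow_nonneg hσ.le _))
    calc _ ≤ K * min (σ ^ (-(1 / 2 : ℝ))) (‖L‖ ^ 2 * σ ^ (-(3 / 2 : ℝ))) * Mf * Mg :=
          hK L f g Mf Mg σ hf hg hpf hpg hMf hMg hσ x
      _ ≤ max (max A K) 1 * min (σ ^ (-(1 / 2 : ℝ))) (‖L‖ ^ 2 * σ ^ (-(3 / 2 : ℝ))) * Mf * Mg := by
          gcongr
          exact le_max_of_le_left (le_max_right _ _)

end Summit.NavierStokesRegularity.NavierStokesRegularity.Cruxes.HelicalEndLiouville.DRefute
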